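import Literature.MathematicalPhysics.QuantumFieldTheory.Balaban1983to89.Beta.Assembly

/-!
# Gaps / CapTailSigns — the CAP of «CAP+tail» WEAKENED FROM THRESHOLDS TO SIGNS: given the tail (the limit-form carrier
# `Beta.Assembly.LimitForm`), Theorem 2 AS PRINTED needs only the finitely many SIGNS `0 < β⁰_{k+1}` (`k < k₀`), not the threshold list
# `3β⁰_∞/4 ≤ β⁰_{k+1}` that `LimitForm.thm2Printed_of_list` consumes (cell pub-balaban-gaps, seat g1-p3, CAP+tail «split ∕ weakening» charge)

HONEST FRAMING (cell rule, page 1 of everything): bookkeeping over the β sub-cell's hypothesis carrier; NOTHING of Bałaban's is asserted beyond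
print; [Balaban1987RG1] Thm 2 is UNPROVED IN PRINT; every field of `LimitForm` except the printed upper bound is a located UNPRINTED input
(b2b rows an1–an4); the finite sign list is the CAP (b2b row CAP-k: certified numerics AT THE CONSTRUCTION'S OWN `L`, print p. 251 «L odd > 11»;
0 coefficients certified to date); NOT the continuum limit, NOT Clay.  HONEST DEPENDENCY (b2b cell, verbatim): «continuum YM on T⁴ ⇐ BetaPertH ∧
nine spine estimates (0/9 proved); BetaPertH ⇐ (D1) ∧ (D4) ∧ CAP+tail; G-an2-4 gates asym, D1 and NE2/3/4.»

WHAT THIS MODULE ADDS (the weakening, kernel-checked).  The β sub-cell's assembly proves Theorem 2 as printed (`B12.Thm2Printed C L`, whose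
(0.31)-constants `β, β'` are EXISTENTIALLY quantified, as in print «there exist constants β, β′, 0 < β ≤ β′») from `LimitForm β` + the THRESHOLD list
`hsmall : ∀ k < k₀, 3β⁰_∞/4 ≤ β⁰_{k+1}` (`LimitForm.thm2Printed`), and records separately that the SIGN list `∀ k < k₀, 0 < β⁰_{k+1}` already gives
SOME uniform floor `0 < b ≤ β⁰_{k+1}` for all `k` (`LimitForm.exists_uniform_beta0_lower`).  Here the two are joined: `thm2Printed_of_signs` —
`LimitForm β` + `ForwardGenerated C β` + the SIGN list ⇒ `B12.Thm2Printed C L` (box shrunk to `γ₂ = min γ₀ (b ∕ (2(C_r+1)))` so that the (AF-1)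
remainder costs at most `b/2`; constants `b/2 ≤ β'`).  CONSEQUENCE FOR ROW CAP-k (numbers, not adjectives): at the construction's `L` the CAP's
computational leaf becomes «certify `β⁰_{k+1}(L) > 0` for `k < k₀`» instead of «certify `β⁰_{k+1}(L) ≥ 3·stepBal N L ∕ 4`»; e.g. SU(2), `L = 13`:
threshold `3·stepBal 2 13/4 = (11/(4π²))·log 13 ≈ 0.7147` (kernel: `> 0.7`, `threshold_two_thirteen_gt`) vs. `0` — the admissible certified-enclosure error grows from `β⁰₁ − 0.715` to the whole
value `β⁰₁` (evidence-grade size `β⁰₁ ≈ stepBal + O(1)`, b2b BETA/CERT.md; at `L = 3` the two-engine non-certified reading is `β⁰₁ = 0.661 ± 0.009`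
vs threshold `0.306`).  The TAIL is untouched (it is `LimitForm.conv`, b2b G-an2-4 ∕ (CONV-C), OPEN).  Also recorded: `betaAFH_of_signs` (discrete
asymptotic freedom from signs) and the necessity witness already in the tree (`Beta.Certified.not_exists_uniform_pos_lower_bound`: the ABELIAN
one-loop sequence `(L⁴−1)/(4L^{4(k+1)})` has all signs but NO uniform floor — so the tail hypothesis is load-bearing in `thm2Printed_of_signs`).
All [folklore]; 0 sorry; 0 new hypotheses about Bałaban's objects.
-/

namespace Summit.QuantumFields.BalabanUV.Gaps.CapTailSigns

open Literature.MathematicalPhysics.QuantumFieldTheory.Balaban1983to89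
open Literature.MathematicalPhysics.QuantumFieldTheory.Balaban1983to89.FlowStep
open Literature.MathematicalPhysics.QuantumFieldTheory.Balaban1983to89.FlowStepRuns
open Literature.MathematicalPhysics.QuantumFieldTheory.Balaban1983to89.DagBinding
open Literature.MathematicalPhysics.QuantumFieldTheory.Balaban1983to89.Beta.Assembly

variable {β : HBeta} (D : LimitForm β)

/-- **A UNIFORM FLOOR ON A SHRUNK BOX FROM THE SIGN LIST.**  Given the limit form and the signs `0 < β⁰_{k+1}` for `k < k₀`, there are `b > 0` and a
box `0 < γ₂ ≤ γ₀` with `b/2 ≤ β_{k+1}(v)` for every `k` and every `v ∈ ]0,γ₂]^{k+1}`: take `b` from `LimitForm.exists_uniform_beta0_lower` and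
`γ₂ = min γ₀ (b/(2(C_r+1)))`, so that (AF-1) `|β¹_{k+1}(v)| ≤ C_r·v_k ≤ C_r γ₂ ≤ b/2`. [folklore] -/
theorem exists_floor_of_signs (hsign : ∀ k, k < D.k₀ → 0 < D.S.β0 k) :
    ∃ b γ₂ : ℝ, 0 < b ∧ 0 < γ₂ ∧ γ₂ ≤ D.γ₀ ∧ BetaLowerH (b / 2) γ₂ β := by
  obtain ⟨b, hb, hfloor⟩ := D.exists_uniform_beta0_lower hsign
  have hCr := D.Cr_nonneg
  refine ⟨b, min D.γ₀ (b / (2 * (D.Cr + 1))), hb, lt_min D.γ₀_pos (by positivity), min_le_left _ _, ?_⟩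
  intro k v hv
  have hγ₂le : min D.γ₀ (b / (2 * (D.Cr + 1))) ≤ D.γ₀ := min_le_left _ _
  have hvbox : v ∈ B12Beta.HistBox D.γ₀ k := fun i => ⟨(mem_box.mp hv i).1, (mem_box.mp hv i).2.trans hγ₂le⟩
  have h1 := abs_le.mp (D.af1 k v hvbox)
  have hvk : v (Fin.last k) ≤ b / (2 * (D.Cr + 1)) := ((mem_box.mp hv (Fin.last k)).2).trans (min_le_right _ _)
  have hvk0 : 0 ≤ v (Fin.last k) := (mem_box.mp hv (Fin.last k)).1.le
  have h2 : D.Cr * v (Fin.last k) ≤ b / 2 := by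
    calc D.Cr * v (Fin.last k) ≤ D.Cr * (b / (2 * (D.Cr + 1))) := mul_le_mul_of_nonneg_left hvk hCr
      _ ≤ b / 2 := by
          rw [mul_div_assoc', div_le_div_iff₀ (by positivity) (by positivity)]
          nlinarith
  rw [D.S.split k v]
  linarith [hfloor k, h1.1]

/-- **DISCRETE ASYMPTOTIC FREEDOM FROM THE SIGN LIST**: `LimitForm β` + `∀ k < k₀, 0 < β⁰_{k+1}` ⇒ `FlowStep.BetaAFH β` (cf. the tree's
`LimitForm.betaAFH_of_smallList`, which asks the thresholds `3β⁰_∞/4 ≤ β⁰_{k+1}`). [folklore] -/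
theorem betaAFH_of_signs (hsign : ∀ k, k < D.k₀ → 0 < D.S.β0 k) : BetaAFH β := by
  obtain ⟨b, γ₂, hb, hγ₂, -, hlo⟩ := exists_floor_of_signs D hsign
  exact ⟨γ₂, hγ₂, b / 2, by positivity, hlo⟩

/-- **[Balaban1987RG1] THEOREM 2 AS PRINTED FROM THE LIMIT FORM + THE SIGN LIST** (forward-generated constructions, block size `L > 1` as a real):
`LimitForm β` + `∀ k < k₀, 0 < β⁰_{k+1}` ⇒ `B12.Thm2Printed C L` — the CAP weakened from the threshold list of `LimitForm.thm2Printed` to signs.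
Proof: the floor `b/2` on the shrunk box (`exists_floor_of_signs`), the printed upper bound and continuity restricted to it, `b/2 ≤ β'` at a box
point, then the tree's `FlowStepRuns.thm2Printed_of_boxBoundsH`. [cite: Balaban1987RG1, Thm 2 (0.31) p.259] -/
theorem thm2Printed_of_signs {C : B12.Construction} (hgen : ForwardGenerated C β) {L : ℝ} (hL : 1 < L)
    (hsign : ∀ k, k < D.k₀ → 0 < D.S.β0 k) : B12.Thm2Printed C L := by
  obtain ⟨b, γ₂, hb, hγ₂, hγ₂le, hlo⟩ := exists_floor_of_signs D hsign
  have hup : BetaUpperH D.β' γ₂ β := D.upper_mono hγ₂le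
  have hcont : BetaContH γ₂ β := D.cont_mono hγ₂le
  have hbβ' : b / 2 ≤ D.β' := by
    have hmem : (fun _ : Fin (0 + 1) => γ₂) ∈ Box γ₂ 0 := mem_box.mpr fun _ => ⟨hγ₂, le_rfl⟩
    exact (hlo 0 _ hmem).trans (hup 0 _ hmem)
  exact thm2Printed_of_boxBoundsH hgen hL hγ₂ (by positivity) hbβ' hcont hlo hup

/-- LIST-LENGTH head (mirrors the tree's `LimitForm.thm2Printed_of_list`; suggested by the CAP-k socket custodian, b2b-balaban-beta-cap3 W-cap3-g88-1):
the asymptotic ∕ numerics rows deliver an admissible LENGTH `k₁` through the rate inequality `c₀θ^{k₁} ≤ β⁰_∞/4` (`LimitForm.k₀_le`), never `Nat.find`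
itself — a sign certificate of length `k₁` plugs in without evaluating `D.k₀`. [cite: Balaban1987RG1, Thm 2 (0.31) p.259] -/
theorem thm2Printed_of_signs_list {C : B12.Construction} (hgen : ForwardGenerated C β) {L : ℝ} (hL : 1 < L) {k₁ : ℕ}
    (hk₁ : D.c₀ * D.θ ^ k₁ ≤ D.binf / 4) (hsign : ∀ k, k < k₁ → 0 < D.S.β0 k) : B12.Thm2Printed C L :=
  thm2Printed_of_signs D hgen hL fun k hk => hsign k (lt_of_lt_of_le hk (D.k₀_le hk₁))

/-- The sign list in the tree's `SmallKCert`∕`CapRows` currency: certified rational lower bounds `0 < lo k ≤ β⁰_{k+1}` for `k < k₀` (the row CAP-k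
leaf `lo_le`, with the threshold test replaced by the SIGN test `0 < lo k`) give Theorem 2 as printed. [cite: Balaban1987RG1, Thm 2 (0.31) p.259] -/
theorem thm2Printed_of_posRows {C : B12.Construction} (hgen : ForwardGenerated C β) {L : ℝ} (hL : 1 < L) (lo : ℕ → ℚ)
    (hlo : ∀ k, k < D.k₀ → ((lo k : ℚ) : ℝ) ≤ D.S.β0 k) (hpos : ∀ k, k < D.k₀ → 0 < lo k) : B12.Thm2Printed C L :=
  thm2Printed_of_signs D hgen hL fun k hk => lt_of_lt_of_le (by exact_mod_cast hpos k hk) (hlo k hk)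

/-- With NO list at all when the threshold scale is `k₀ = 0` (e.g. constant one-loop coefficients, `LimitForm.k₀_eq_zero`). [folklore] -/
theorem thm2Printed_of_k₀_eq_zero {C : B12.Construction} (hgen : ForwardGenerated C β) {L : ℝ} (hL : 1 < L) (hk : D.k₀ = 0) :
    B12.Thm2Printed C L :=
  thm2Printed_of_signs D hgen hL fun k hk' => absurd hk' (by rw [hk]; exact Nat.not_lt_zero k)

/-- NUMBERS FOR ROW CAP-k (SU(2), `L = 13`, the smallest print-admissible block size): the threshold the old list asks of `β⁰₁` is
`3·stepBal 2 13 ∕ 4 = (11/(4π²))·log 13 ≈ 0.7147 > 0.7`, while the sign list asks `> 0`.  (Kernel bound via `π < 3.15`, `log 2 > 0.6931471803`,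
`log(16/13) ≤ 3/13`; `B12Normalization.stepBal N L = (11N²/(12π²))·log L`.) [folklore] -/
theorem threshold_two_thirteen_gt : (0.7 : ℝ) < 3 * B12Normalization.stepBal 2 13 / 4 := by
  rw [B12Normalization.stepBal_eq]
  have hπ := Real.pi_lt_d2
  have hπ0 := Real.pi_pos
  have hlog2 := Real.log_two_gt_d9
  -- log 13 = log 16 − log (16/13) ≥ 4·log 2 − 3/13
  have h16 : Real.log 16 = 4 * Real.log 2 := by
    rw [show (16 : ℝ) = 2 ^ 4 by norm_num, Real.log_pow]; norm_num
  have hdiv : Real.log (16 / 13) = Real.log 16 - Real.log 13 := Real.log_div (by norm_num) (by norm_num)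
  have hle : Real.log (16 / 13) ≤ 16 / 13 - 1 := Real.log_le_sub_one_of_pos (by norm_num)
  have hlog13 : (2.5418 : ℝ) < Real.log 13 := by linarith
  have hπ2 : Real.pi ^ 2 < 9.9225 := by nlinarith
  have hcoef : (0.3695 : ℝ) < 11 * (2:ℝ) ^ 2 / (12 * Real.pi ^ 2) := by
    rw [lt_div_iff₀ (by positivity)]; nlinarith
  have hprod : (0.3695 : ℝ) * 2.5418 < 11 * (2:ℝ) ^ 2 / (12 * Real.pi ^ 2) * Real.log 13 := by
    have h0 : (0 : ℝ) < 11 * (2:ℝ) ^ 2 / (12 * Real.pi ^ 2) := by positivity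
    nlinarith
  nlinarith

end Summit.QuantumFields.BalabanUV.Gaps.CapTailSigns
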